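import Literature.MathematicalPhysics.QuantumFieldTheory.Balaban1983to89.B3Op116CollarHolder
import Literature.MathematicalPhysics.QuantumFieldTheory.Balaban1983to89.B3Op116CollarBinders

/-!
# Bałaban, *(Higgs)₂,₃ quantum fields in a finite volume III. Renormalization* [B3] — the kernel of the operator (1.16) p. 414 at
FAR-SEPARATED arguments, file «CollarHolderBinder» of the cell's Route δ (class (c) of p. 433): THE HÖLDER BINDER (`α > 0`) of the
one-`V_k` collar operator — the NEAR/FAR SPLIT in `|x₁ − x₂|`, the contour geometry, and the two-anchor row of `B3Op116CollarHolder` fed by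
the (2.11) two-anchor dictionary

statement-level skeleton of published theorems with citation tags; proofs where landed; nothing here is a claim about the Yang–Mills mass gap

T. Bałaban, Commun. Math. Phys. **88** (1983) 411–445 [cite: Balaban1983Higgs3]; part I, Commun. Math. Phys. **85** (1982) 603–636
[cite: Balaban1982Higgs1].  PDFs held: `paper:balaban1983-higgs-2-3-quantum-fields-finite-volume` (p. 414 = `p0004.txt`, p. 426 =
`p0016.txt`, p. 433 = `p0023.txt`).

CITATION HEADER (lean-in-tree rule).  Cell `lit-balaban` (HOME `run/shared/lean/pub/lit-balaban/`), Phase-2 proof seat **p40** gen 77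
(unit `lit-balaban-p40`); free-target protocol G.5-34(d), TAKING line HOME/STATUS.md 2026-08-23T12:41:06Z (cc r15 = fold owner of rows
B3.Txt@433 / B3.Prop1 / B3.Eq1.16 / B3.Eq2.5 / B3.Eq2.11, p35, r14, p33); design note `lit-balaban-p40/DESIGN-B3-116-box.md` v3 §5/§5.1 and
§7.3 item 2 (Route δ; HOME/GAPS.md «G-B3-16 ADDENDUM 1», owner note l.2887).  LOCATED SUPPORT FILE — no head claim.  USED BY NAME, never
restated: p40 g77's `B3Op116CollarHolder.{holder_row_collar_le, holT_propagatorK_single_eq_zero}`, `B3Op116CollarBinders.{col_state_all,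
sum_dY_le_maj}`, `B3Op116CollarRows.{top, farF, farC, faceC, collarC, mul_top}`, `B3Op116CollarSources.{inB, exB, enB, mem_inB}`, p35's
`B3Op116MajorantStep.{maj, mul_maj}`, `B3Op116HolderKernelRegularTorus.{holT, holT_apply, mesh_rpow_split_holder}`, `B3Op116LeibnizRows.pred`,
r14's `B3Ineq210RegularRegion.Interior`, `B3Ineq211RegularTorus.IsAdm`, the typer's `B1TorusChainTransport.{hol, IsTChain, TNbr, norm_hol_apply}`,
`B1Ineq234LevelZero.{tdist_triangle_real, tdist_shift_le_one, tdist_comm}`.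

## What is printed

[B3] p. 414 [PDF 4]: *"the Hölder norms of the covariant derivatives of this kernel … are exponentially decaying with the distance of the
arguments and are uniformly bounded by O(1)(e(L^kε)^{1−α})^{n+n′}, where α > 0 but can be arbitrarily small."*; p. 426 (2.11) [PDF 16].

## What this file proves, and how

§1 contour geometry: every site of a lattice chain `Γ` from `x` is within (1.3)-distance `|Γ|` of `x` (`tdist_le_length_of_isTChain`); hence an
admissible contour between NEAR interior points (`|x₁ − x₂| < L^k`) stays in the region (`mem_of_isAdm_near`, `K₀ ≥ 1`).
§2 **the FAR pairs** (`L^kε ≤ ε|x₁ − x₂|`): the transported difference is two derivative rows (`‖U(Γ)v − u‖ ≤ ‖v‖ + ‖u‖`) and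
`(L^kε)^α ≤ (ε|x₁−x₂|)^α` — `holder_far_of_deriv_row`, any operator `T`, any set of good points (twin of F3's `holder_row_zero_of_deriv_row`).
§3 **the NEAR pairs through F4**: `holder_near_le` — for `T = holT_{x₁,x₂,Γ,μ} ∘ G_k(Ω,X)` with a two-anchor column bound
`Σ_i‖Te_{(y,i)}‖ ≤ (ε|x₁−x₂|)^α(𝔪(c_H,1−α)(x₁,y) + 𝔪(c_H,1−α)(x₂,y))` at the sources `y ∈ Ω` (the (2.11) dictionary, p35 g21's
`B3Op116BoxRows.hcolB_le`), states `G_k(Ω,X′)e_{(x′,i′)}` with their (2.10) columns, the face family and the far geometry: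
`(ε^d)^{−1}Σ_{i′}‖T(V_k^Ω(P,Y)G_k(Ω,X′)e_{(x′,i′)})‖ ≤ (ε|x₁−x₂|)^α·C_H^{near}·L^kε·((L^kε)((L^kε)^d)^{−1}((L^kε)^α)^{−1})·e^{−(δ/4)min(|x₁−x′|,|x₂−x′|)/L^k}`.

## Honest scope

(B)-level pieces of the `α > 0` Hölder binder; the case split assembled into the `hH`/`hH′` binders of `B3Ineq25Op116SmoothInner` (with
the `hol`/`D^ε` background conversions along near contours, `B1TorusChainTransport.hol_congr`), the face family of a cell-product box and the
(C)-level discharge by `hcolB_le` are the sibling files `B3Ineq25Op116CollarRegionHolder`, `B3Op116CollarBoxFaces`, `B3Op116CollarConfig`.  The class-(c) use on `□` is a RECORDED ROUTE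
DEVIATION from p. 433 l.12–15 (G-B3-16.A1).  Theorems only: no `def`, no `def … : Prop`, no new named fact, no `sorry`; axioms standard.
-/

noncomputable section

open scoped BigOperators

namespace Literature.MathematicalPhysics.QuantumFieldTheory.Balaban1983to89.B3Op116CollarHolderBinder

open HiggsLattice (ChargeData ScalarField covDeriv)
open HiggsCovariance (propagatorK E)
open HiggsCovariancePos (Inside)
open HiggsAveraging (blockK blockIter)
open B1Eq230FluctCov (Ix cb)
open B1TorusChainTransport (hol IsTChain TNbr)
open B1Ineq234LevelZero (tdist_triangle_real tdist_shift_le_one tdist_comm)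
open B1TorusCubeCover (half)
open B3Ineq211RegularTorus (IsAdm)
open B3Ineq210RegularRegion (Interior)
open B1TorusCubeLocality26 (rS)
open B3Ineq210MixedRegularTorus (onb dip)
open B3Eq116TwoSidedExpansion (op116)
open B3Op116SourceForm (srcV)
open B3Op116MajorantStep (maj maj_nonneg mul_maj)
open B3Op116LeibnizRows (pred)
open B3Op116CollarRows (Far top farF farC faceC collarC mul_top top_nonneg farF_pos farC_pos faceC_nonneg collarC_nonneg)
open B3Op116CollarSources (inB exB enB mem_inB)
open B3Op116CollarHolder (holder_row_collar_le holT_propagatorK_single_eq_zero)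
open B3Op116CollarBinders (col_state_all sum_dY_le_maj)
open B3Op116HolderKernelRegularTorus (holT holT_apply mesh_rpow_split_holder)

variable {P : HiggsLattice.Params} {N : ℕ}

/-! ## §1 Contour geometry -/

section Geometry

/-- Every site of a lattice chain from `x` is within (1.3)-distance `|Γ|` of `x`. [cite: Balaban1982Higgs1, (1.3) p.604] [cite: Balaban1983RegularityDecay, p.572] -/
theorem tdist_le_length_of_isTChain :
    ∀ (x : HiggsLattice.Site P 0) (Γ : List (HiggsLattice.Site P 0)), IsTChain x Γ →
      ∀ z ∈ Γ, (HiggsLattice.Site.tdist x z : ℝ) ≤ (Γ.length : ℝ)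
  | x, [], _, z, hz => absurd hz (by simp)
  | x, y :: l, hch, z, hz => by
    have hxy : (HiggsLattice.Site.tdist x y : ℝ) ≤ 1 := by
      obtain ⟨μ, h | h⟩ := hch.1
      · rw [h]; exact_mod_cast tdist_shift_le_one x μ
      · rw [h, tdist_comm]; exact_mod_cast tdist_shift_le_one y μ
    rw [List.length_cons, Nat.cast_succ]
    rcases List.mem_cons.1 hz with rfl | hz'
    · have : (0 : ℝ) ≤ (l.length : ℝ) := Nat.cast_nonneg _
      linarith
    · have ih := tdist_le_length_of_isTChain y l hch.2 z hz'
      have htri := tdist_triangle_real x y z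
      linarith

/-- **An admissible contour between NEAR interior points stays in the region**: if `x₁` is an interior point of `Ω₂` (cube size `K₀ ≥ 1`),
`|x₁ − x₂| < L^k` and `Γ` is admissible (`|Γ| ≤ d|x₁ − x₂|`), then every site of `Γ` lies in `Ω₂`.
[cite: Balaban1982Higgs1, Prop. 2.1 p.610, (1.3) p.604] [cite: Balaban1983Higgs3, (2.11) p.426] -/
theorem mem_of_isAdm_near {k K₀ : ℕ} (hK₀ : 1 ≤ K₀) {Ω₂ : Finset (HiggsLattice.Site P 0)} {x₁ x₂ : HiggsLattice.Site P 0}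
    (hx₁ : Interior k K₀ Ω₂ x₁) (hnear : (HiggsLattice.Site.tdist x₁ x₂ : ℝ) ≤ (P.L : ℝ) ^ k)
    {Γ : List (HiggsLattice.Site P 0)} (hΓ : IsAdm x₁ x₂ Γ) : ∀ z ∈ Γ, z ∈ Ω₂ := by
  intro z hz
  apply hx₁
  have h1 := tdist_le_length_of_isTChain x₁ Γ hΓ.1 z hz
  have h2 : (Γ.length : ℝ) ≤ (P.d : ℝ) * (HiggsLattice.Site.tdist x₁ x₂ : ℝ) := hΓ.2.2
  have hd0 : (0 : ℝ) ≤ (P.d : ℝ) := Nat.cast_nonneg _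
  have h3 : (HiggsLattice.Site.tdist x₁ z : ℝ) ≤ (P.d : ℝ) * (P.L : ℝ) ^ k := h1.trans (h2.trans (mul_le_mul_of_nonneg_left hnear hd0))
  -- `d·L^k ≤ 2·half·(d+1) ≤ the interior radius`
  have hhalf : (P.L : ℝ) ^ k ≤ (half P k K₀ : ℝ) := by
    unfold half; push_cast
    have : (1 : ℝ) ≤ (K₀ : ℝ) := by exact_mod_cast hK₀
    have hL : (0 : ℝ) ≤ (P.L : ℝ) ^ k := by positivity
    nlinarith
  have h4 : (P.d : ℝ) * (P.L : ℝ) ^ k ≤ (2 * rS P k K₀ + 2 * half P k K₀ * (P.d + 1) + 1 : ℕ) := by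
    push_cast
    have hr : (0 : ℝ) ≤ (rS P k K₀ : ℝ) := Nat.cast_nonneg _
    nlinarith
  exact_mod_cast h3.trans h4

end Geometry

/-! ## §2 The far pairs: two derivative rows -/

section Far

variable (C : ChargeData N) (B : HiggsLattice.VecField P 0) {k : ℕ}

/-- **FAR PAIRS (`L^kε ≤ ε|x₁ − x₂|`): THE TRANSPORTED-DIFFERENCE BINDER FROM THE ROW-DERIVATIVE BINDER**, any `α ≥ 0`: for any operator `T`
and any set of good points, the `hDv` shape of the (1.32)-norm assembly implies the `hH` shape at far pairs with `C_H = 2C_D`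
(`‖U(B(Γ))v − u‖ ≤ ‖v‖ + ‖u‖`; `(L^kε)·((L^kε)^α)^{−1}·(ε|x₁−x₂|)^α ≥ L^kε`). [cite: Balaban1983Higgs3, (2.5) p.424, (2.11) p.426, (1.16) p.414] [cite: Balaban1982Higgs1, Prop. 2.1 (2.24) p.610] -/
theorem holder_far_of_deriv_row (T : Module.End ℝ (ScalarField P 0 N)) (Good : HiggsLattice.Site P 0 → Prop) {CD t δ α : ℝ}
    (hCDt : 0 ≤ CD * t) (hδ : 0 ≤ δ) (hα : 0 ≤ α)
    (hDv : ∀ (μ : Fin P.d) (x x' : HiggsLattice.Site P 0), Good x → Good x' →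
      (P.mesh 0 ^ P.d)⁻¹ * ∑ i' : Ix N, ‖covDeriv C B (T (cb P N 0 (x', i'))) ⟨x, μ⟩‖
        ≤ CD * t * (P.mesh k * (P.mesh k ^ P.d)⁻¹) * Real.exp (-(δ * ((HiggsLattice.Site.tdist x x' : ℝ) / (P.L : ℝ) ^ k))))
    (μ : Fin P.d) (x₁ x₂ x' : HiggsLattice.Site P 0) (Γ : List (HiggsLattice.Site P 0))
    (hx₁ : Good x₁) (hx₂ : Good x₂) (hx' : Good x') (hfar : P.mesh k ≤ P.mesh 0 * (HiggsLattice.Site.tdist x₁ x₂ : ℝ)) :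
    (P.mesh 0 ^ P.d)⁻¹ * ∑ i' : Ix N, ‖hol C B x₁ Γ (covDeriv C B (T (cb P N 0 (x', i'))) ⟨x₂, μ⟩)
        - covDeriv C B (T (cb P N 0 (x', i'))) ⟨x₁, μ⟩‖
      ≤ (P.mesh 0 * (HiggsLattice.Site.tdist x₁ x₂ : ℝ)) ^ α *
          ((2 * CD) * t * (P.mesh k * (P.mesh k ^ P.d)⁻¹ * (P.mesh k ^ α)⁻¹)) *
          Real.exp (-(δ * (min (HiggsLattice.Site.tdist x₁ x' : ℝ) (HiggsLattice.Site.tdist x₂ x' : ℝ) / (P.L : ℝ) ^ k))) := by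
  have h0 := B3Op116CollarKernel.holder_row_zero_of_deriv_row C B T Good hCDt hδ hDv μ x₁ x₂ x' Γ hx₁ hx₂ hx'
  rw [Real.rpow_zero, Real.rpow_zero, inv_one, mul_one, one_mul] at h0
  refine h0.trans ?_
  have hm : 0 < P.mesh k := P.mesh_pos k
  have hmα : 0 < P.mesh k ^ α := Real.rpow_pos_of_pos hm α
  have hq : P.mesh k ^ α ≤ (P.mesh 0 * (HiggsLattice.Site.tdist x₁ x₂ : ℝ)) ^ α := Real.rpow_le_rpow hm.le hfar hα
  have hE : 0 ≤ Real.exp (-(δ * (min (HiggsLattice.Site.tdist x₁ x' : ℝ) (HiggsLattice.Site.tdist x₂ x' : ℝ) / (P.L : ℝ) ^ k))) :=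
    Real.exp_nonneg _
  have hW : 0 ≤ 2 * CD * t * (P.mesh k * (P.mesh k ^ P.d)⁻¹ * (P.mesh k ^ α)⁻¹) := by
    have : 0 ≤ 2 * (CD * t) := by positivity
    have h2 : 0 ≤ P.mesh k * (P.mesh k ^ P.d)⁻¹ * (P.mesh k ^ α)⁻¹ := by positivity
    nlinarith
  calc 2 * CD * t * (P.mesh k * (P.mesh k ^ P.d)⁻¹) *
        Real.exp (-(δ * (min (HiggsLattice.Site.tdist x₁ x' : ℝ) (HiggsLattice.Site.tdist x₂ x' : ℝ) / (P.L : ℝ) ^ k)))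
      = P.mesh k ^ α * (2 * CD * t * (P.mesh k * (P.mesh k ^ P.d)⁻¹ * (P.mesh k ^ α)⁻¹)) *
          Real.exp (-(δ * (min (HiggsLattice.Site.tdist x₁ x' : ℝ) (HiggsLattice.Site.tdist x₂ x' : ℝ) / (P.L : ℝ) ^ k))) := by
        field_simp
    _ ≤ _ := mul_le_mul_of_nonneg_right (mul_le_mul_of_nonneg_right hq hW) hE

end Far

/-! ## §3 The near pairs through F4's two-anchor row -/

section Near

open scoped Classical

variable (C : ChargeData N) (Ω : Finset (HiggsLattice.Site P 0)) (Pf Y X X' : HiggsLattice.VecField P 0) {msq : ℝ} (a : ℝ) {k : ℕ}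
  (hmsq : 0 < msq) (hak : 0 ≤ B1.aSeq a P.L k)
  (hΩ : ∀ x x' : HiggsLattice.Site P 0, blockIter k x = blockIter k x' → (x ∈ Ω ↔ x' ∈ Ω))
include hmsq hak hΩ

omit hmsq hak hΩ in
/-- linearity of the engine's constant in the kernel constant. [cite: Balaban1983Higgs3, (2.10) p.426] -/
theorem collarC_kernel_linear' (k : ℕ) (δ aK av θ cH cv cd κ₁ κ₂ κ₃ κ₄ : ℝ) :
    collarC P N k δ aK 0 av (θ * cH) 0 cv cd κ₁ κ₂ κ₃ 0 0 κ₄ = θ * collarC P N k δ aK 0 av cH 0 cv cd κ₁ κ₂ κ₃ 0 0 κ₄ := by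
  unfold collarC; ring

/-- **NEAR PAIRS: THE TWO-ANCHOR ROW OF THE COLLAR OPERATOR WITH THE (2.11) DICTIONARY AS KERNEL INPUT.**  `Ω` a `k`-block union,
outer propagator `G_k(Ω,X)`, states `G_k(Ω,X′)e_{(x′,i′)}` (`x′ ∈ Ω`), the bonds `⟨x₁,x₁+εe_μ⟩, ⟨x₂,x₂+εe_μ⟩ ⊂ Ω`, a contour `Γ`, a weight
`θ ≥ 0` (`= (ε|x₁−x₂|)^α`) and an exponent `a_K ≥ 0` (`= 1 − α`).  GIVEN the two-anchor bound of the Hölder functional on the columns of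
`G_X` at the sources `y ∈ Ω` (`Σ_i‖T e_{(y,i)}‖ ≤ θ(𝔪(c_H,a_K)(x₁,y) + 𝔪(c_H,a_K)(x₂,y))`, `T = holT_{x₁,x₂,Γ,μ} ∘ G_k(Ω,X)`), the (2.10) columns
of the states everywhere and their `Y`-derivatives at the charged bonds inside `Ω`, the face family and the far geometry, THEN
`Σ_{i′}‖T(V_k^Ω(P,Y)G_k(Ω,X′)e_{(x′,i′)})‖ ≤ θ·[top(farF·collarC(a_K,0,2;c_H,…),a_K+1;δ/4)(x₁,x′) + (x₂) + |Fc|·d·(κ_ex+κ_en)·(top(farF·c_H·farC·c_v·faceC(δ/2),a_K+1;δ/4)(x₁,x′) + (x₂))]`.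
[cite: Balaban1983Higgs3, (1.16) p.414, (2.11) p.426, p.433] [cite: Balaban1982Higgs1, (3.16) p.615] -/
theorem holder_near_le (hL2 : 2 ≤ P.L) (hkK : k ≤ P.K) {δ ρ : ℝ} (hδ : 0 < δ) (hδ1 : δ ≤ 1) (hρ : 1 ≤ ρ)
    {s δA cH cv cd aK θ : ℝ} (hs : 0 ≤ s) (hδA : 0 ≤ δA) (hcH : 0 ≤ cH) (hcv : 0 ≤ cv) (hcd : 0 ≤ cd) (haK : 0 ≤ aK) (hθ : 0 ≤ θ)
    (hP : ∀ b : HiggsLattice.PBond P 0, |Pf b| ≤ s)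
    (hregP : ∀ (z : HiggsLattice.Site P 0) (μ ν : Fin P.d), |Pf ⟨z.shift ν, μ⟩ - Pf ⟨z, μ⟩| ≤ δA) (i₀ : Ix N)
    {x₁ x₂ x' : HiggsLattice.Site P 0} {μ : Fin P.d} (hx₁ : x₁ ∈ Ω) (hx₁' : x₁.shift μ ∈ Ω) (hx₂ : x₂ ∈ Ω) (hx₂' : x₂.shift μ ∈ Ω)
    (hx' : x' ∈ Ω) (Γ : List (HiggsLattice.Site P 0))
    (hH2 : ∀ y ∈ Ω, ∑ i : Ix N, ‖holT C Y x₁ x₂ Γ μ (propagatorK C Ω X msq a k (cb P N 0 (y, i)))‖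
      ≤ θ * (maj P k cH aK δ x₁ y + maj P k cH aK δ x₂ y))
    (hV : ∀ u, ∑ i' : Ix N, ‖propagatorK C Ω X' msq a k (cb P N 0 (x', i')) u‖ ≤ maj P k cv 2 δ u x')
    (hD : ∀ b ∈ inB Ω Pf, ∑ i' : Ix N, ‖covDeriv C Y (propagatorK C Ω X' msq a k (cb P N 0 (x', i'))) b‖ ≤ maj P k cd 1 δ b.src x')
    (Fc : Finset (Σ ν : Fin P.d, ZMod (P.sitesPerDir 0 ν)))
    (hexF : ∀ b ∈ exB Ω Pf, ∃ f ∈ Fc, b.src f.1 = f.2) (henF : ∀ b ∈ enB Ω Pf, ∃ f ∈ Fc, b.tgt f.1 = f.2)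
    (hfar : ∀ b : HiggsLattice.PBond P 0, (Pf b ≠ 0 ∨ Pf (pred b) ≠ 0) →
      Far P k ρ x₁ b.src ∧ Far P k ρ x₂ b.src ∧ Far P k ρ b.src x')
    (hfarT : ∀ b : HiggsLattice.PBond P 0, Pf b ≠ 0 → Far P k ρ x₁ b.tgt ∧ Far P k ρ x₂ b.tgt ∧ Far P k ρ b.tgt x')
    (hfarZ : ∀ b : HiggsLattice.PBond P 0, Pf b ≠ 0 → ∀ z : HiggsLattice.Site P 0, blockIter k z = blockIter k b.src →
      Far P k ρ x₁ z ∧ Far P k ρ x₂ z) :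
    ∑ i' : Ix N, ‖holT C Y x₁ x₂ Γ μ (propagatorK C Ω X msq a k (srcV C Pf Y k Ω a (propagatorK C Ω X' msq a k (cb P N 0 (x', i')))))‖
      ≤ θ * ((top P k (farF P δ ρ * collarC P N k δ aK 0 2 cH 0 cv cd (|C.e| * s) ((P.mesh 0)⁻¹ * (|C.e| * δA)) ((|C.e| * s) ^ 2) 0 0
                (|B1.aSeq a P.L k| * (P.mesh k)⁻¹ ^ 2 *
                  ((|C.e| * s * P.mesh 0 * (P.d * ((P.L : ℝ) ^ k - 1))) * (2 + |C.e| * s * P.mesh 0 * (P.d * ((P.L : ℝ) ^ k - 1))))))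
              (aK + 2 - 1) (δ / 4) x₁ x'
            + top P k (farF P δ ρ * collarC P N k δ aK 0 2 cH 0 cv cd (|C.e| * s) ((P.mesh 0)⁻¹ * (|C.e| * δA)) ((|C.e| * s) ^ 2) 0 0
                (|B1.aSeq a P.L k| * (P.mesh k)⁻¹ ^ 2 *
                  ((|C.e| * s * P.mesh 0 * (P.d * ((P.L : ℝ) ^ k - 1))) * (2 + |C.e| * s * P.mesh 0 * (P.d * ((P.L : ℝ) ^ k - 1))))))
              (aK + 2 - 1) (δ / 4) x₂ x')
          + (Fc.card : ℝ) * P.d *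
              (((P.mesh 0)⁻¹ * (|C.e| * δA) + (P.mesh 0)⁻¹ * (|C.e| * s)) + (3 * ((P.mesh 0)⁻¹ * (|C.e| * s)) + 2 * (|C.e| * s) ^ 2)) *
            (top P k (farF P δ ρ * cH * (farC P δ * cv) * faceC P (δ / 2)) (aK + 2 - 1) (δ / 4) x₁ x'
              + top P k (farF P δ ρ * cH * (farC P δ * cv) * faceC P (δ / 2)) (aK + 2 - 1) (δ / 4) x₂ x')) := by
  set T : ScalarField P 0 N →ₗ[ℝ] E N :=
    holT C Y x₁ x₂ Γ μ ∘ₗ (propagatorK C Ω X msq a k : ScalarField P 0 N →ₗ[ℝ] ScalarField P 0 N) with hT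
  have hTk : ∀ y : HiggsLattice.Site P 0, y ∉ Ω → ∀ v : E N, T (Pi.single y v) = 0 := fun y hy v =>
    holT_propagatorK_single_eq_zero C Ω Y a hmsq hak hΩ X hx₁ hx₁' hx₂ hx₂' Γ hy v
  have hw : ∀ (i' : Ix N) (y : HiggsLattice.Site P 0), y ∉ Ω → propagatorK C Ω X' msq a k (cb P N 0 (x', i')) y = 0 :=
    fun i' y hy => B3Op116CollarSources.propagatorK_cb_apply_eq_zero_of_mem C Ω X' a hmsq hak hΩ hx' hy i'
  -- the kernel bound at every source (off `Ω` the functional vanishes)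
  have hK : ∀ y, ∑ i : Ix N, ‖T (cb P N 0 (y, i))‖ ≤ maj P k (θ * cH) aK δ x₁ y + maj P k (θ * cH) aK δ x₂ y := by
    intro y
    by_cases hy : y ∈ Ω
    · have h := hH2 y hy
      rw [mul_add, mul_maj, mul_maj] at h
      simpa only [hT, LinearMap.coe_comp, Function.comp_apply] using h
    · refine le_of_eq_of_le (Finset.sum_eq_zero fun i _ => ?_)
        (add_nonneg (maj_nonneg (mul_nonneg hθ hcH) x₁ y) (maj_nonneg (mul_nonneg hθ hcH) x₂ y))
      rw [B3Ineq210MixedRegularTorus.cb_eq_single, hTk y hy, norm_zero]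
  have h := holder_row_collar_le C Ω Pf Y a hL2 hkK hδ hδ1 hρ (av := 2) hs hδA (mul_nonneg hθ hcH) hcv hcd haK (by norm_num) hP hregP i₀
    T hTk x₁ x₂ x' (fun i' => propagatorK C Ω X' msq a k (cb P N 0 (x', i'))) hw hK hV
    (fun b hb => by rw [show (2 : ℝ) - 1 = 1 by norm_num]; exact hD b hb) Fc hexF henF hfar hfarT hfarZ
  have hLHS : ∀ i' : Ix N, T (srcV C Pf Y k Ω a (propagatorK C Ω X' msq a k (cb P N 0 (x', i'))))
      = holT C Y x₁ x₂ Γ μ (propagatorK C Ω X msq a k (srcV C Pf Y k Ω a (propagatorK C Ω X' msq a k (cb P N 0 (x', i'))))) :=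
    fun i' => by rw [hT, LinearMap.coe_comp, Function.comp_apply]
  simp only [hLHS] at h
  rw [collarC_kernel_linear' (P := P) (N := N)] at h
  refine h.trans (le_of_eq ?_)
  simp only [top]
  ring

end Near

/-! ## §4 The near pairs in the binder currency of the (1.32)-norm assembly -/

section NearCurrency

open scoped Classical

variable (C : ChargeData N) (Ω : Finset (HiggsLattice.Site P 0)) (Pf Y X X' : HiggsLattice.VecField P 0) {msq : ℝ} (a : ℝ) {k : ℕ}
  (hmsq : 0 < msq) (hak : 0 ≤ B1.aSeq a P.L k)
  (hΩ : ∀ x x' : HiggsLattice.Site P 0, blockIter k x = blockIter k x' → (x ∈ Ω ↔ x' ∈ Ω))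
include hmsq hak hΩ

omit hmsq hak hΩ in
/-- a top bump of exponent `2 − α` at either anchor is below the two-anchor `min` profile in the Hölder binder currency:
`(ε^d)^{−1}·top_k(c, 1−α+2−1; δ′)(x_i,x′) ≤ (ε^d)^{−1}c·L^kε·((L^kε)((L^kε)^d)^{−1}((L^kε)^α)^{−1})·e^{−δ′min(|x₁−x′|,|x₂−x′|)/L^k}`.
[cite: Balaban1983Higgs3, (2.5) p.424, (2.11) p.426] -/
theorem top_le_holder_currency {c : ℝ} (hc : 0 ≤ c) (α : ℝ) {δ' : ℝ} (hδ' : 0 ≤ δ') (x₁ x₂ x' : HiggsLattice.Site P 0) (i : Bool) :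
    (P.mesh 0 ^ P.d)⁻¹ * top P k c (1 - α + 2 - 1) δ' (if i then x₁ else x₂) x'
      ≤ ((P.mesh 0 ^ P.d)⁻¹ * c) * P.mesh k * (P.mesh k * (P.mesh k ^ P.d)⁻¹ * (P.mesh k ^ α)⁻¹) *
          Real.exp (-(δ' * (min (HiggsLattice.Site.tdist x₁ x' : ℝ) (HiggsLattice.Site.tdist x₂ x' : ℝ) / (P.L : ℝ) ^ k))) := by
  have hm : 0 < P.mesh k := P.mesh_pos k
  have hm0 : 0 < P.mesh 0 := P.mesh_pos 0
  have hLk : (0 : ℝ) < (P.L : ℝ) ^ k := pow_pos (by exact_mod_cast P.hL) k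
  have hpow : P.mesh k ^ (1 - α + 2 - 1 - (P.d : ℝ)) = P.mesh k * (P.mesh k * (P.mesh k ^ P.d)⁻¹ * (P.mesh k ^ α)⁻¹) := by
    rw [show (1 : ℝ) - α + 2 - 1 - (P.d : ℝ) = (1 : ℝ) + ((1 : ℕ) : ℝ) - α - (P.d : ℝ) by push_cast; ring, mesh_rpow_split_holder,
      pow_one]
  have hmk : P.mesh k = (P.L : ℝ) ^ k * P.mesh 0 := by
    have h := B3Op116CollarRows.mesh_eq_pow_mul_mesh (P := P) (Nat.zero_le k); rwa [Nat.sub_zero] at h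
  have hrate : ∀ z : HiggsLattice.Site P 0, δ' * (P.mesh k)⁻¹ * (P.mesh 0 * (HiggsLattice.Site.tdist z x' : ℝ))
      = δ' * ((HiggsLattice.Site.tdist z x' : ℝ) / (P.L : ℝ) ^ k) := fun z => by
    rw [hmk, mul_inv, div_eq_mul_inv]; field_simp
  have hE : ∀ z : HiggsLattice.Site P 0, min (HiggsLattice.Site.tdist x₁ x' : ℝ) (HiggsLattice.Site.tdist x₂ x' : ℝ)
      ≤ (HiggsLattice.Site.tdist z x' : ℝ) →
      Real.exp (-(δ' * ((HiggsLattice.Site.tdist z x' : ℝ) / (P.L : ℝ) ^ k)))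
        ≤ Real.exp (-(δ' * (min (HiggsLattice.Site.tdist x₁ x' : ℝ) (HiggsLattice.Site.tdist x₂ x' : ℝ) / (P.L : ℝ) ^ k))) := by
    intro z hz
    rw [Real.exp_le_exp]
    have := div_le_div_of_nonneg_right hz hLk.le
    nlinarith
  have hW : 0 ≤ ((P.mesh 0 ^ P.d)⁻¹ * c) * P.mesh k * (P.mesh k * (P.mesh k ^ P.d)⁻¹ * (P.mesh k ^ α)⁻¹) := by
    have := Real.rpow_pos_of_pos hm α
    positivity
  cases i with
  | true =>
    simp only [if_true, top, hpow, hrate]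
    calc (P.mesh 0 ^ P.d)⁻¹ * (c * (P.mesh k * (P.mesh k * (P.mesh k ^ P.d)⁻¹ * (P.mesh k ^ α)⁻¹)) *
          Real.exp (-(δ' * ((HiggsLattice.Site.tdist x₁ x' : ℝ) / (P.L : ℝ) ^ k))))
        = ((P.mesh 0 ^ P.d)⁻¹ * c) * P.mesh k * (P.mesh k * (P.mesh k ^ P.d)⁻¹ * (P.mesh k ^ α)⁻¹) *
          Real.exp (-(δ' * ((HiggsLattice.Site.tdist x₁ x' : ℝ) / (P.L : ℝ) ^ k))) := by ring
      _ ≤ _ := mul_le_mul_of_nonneg_left (hE x₁ (min_le_left _ _)) hW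
  | false =>
    simp only [top, hpow, hrate]
    calc (P.mesh 0 ^ P.d)⁻¹ * (c * (P.mesh k * (P.mesh k * (P.mesh k ^ P.d)⁻¹ * (P.mesh k ^ α)⁻¹)) *
          Real.exp (-(δ' * ((HiggsLattice.Site.tdist x₂ x' : ℝ) / (P.L : ℝ) ^ k))))
        = ((P.mesh 0 ^ P.d)⁻¹ * c) * P.mesh k * (P.mesh k * (P.mesh k ^ P.d)⁻¹ * (P.mesh k ^ α)⁻¹) *
          Real.exp (-(δ' * ((HiggsLattice.Site.tdist x₂ x' : ℝ) / (P.L : ℝ) ^ k))) := by ring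
      _ ≤ _ := mul_le_mul_of_nonneg_left (hE x₂ (min_le_right _ _)) hW

/-- **NEAR PAIRS IN THE BINDER CURRENCY**: under the hypotheses of `holder_near_le` with `θ = (ε|x₁−x₂|)^α`, `a_K = 1 − α`:
`(ε^d)^{−1}Σ_{i′}‖holT(G_X V_k^Ω G_{X′}e_{(x′,i′)})‖ ≤ (ε|x₁−x₂|)^α·(C_H^{near}·L^kε·((L^kε)((L^kε)^d)^{−1}((L^kε)^α)^{−1}))·e^{−(δ/4)min/L^k}` with
`C_H^{near} = 2(ε^d)^{−1}farF·[collarC(1−α,0,2;c_H,…) + |Fc|·d·(κ_ex+κ_en)·c_H·farC·c_v·faceC(δ/2)]`.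
[cite: Balaban1983Higgs3, (2.5) p.424, (1.16) p.414, (2.11) p.426, p.433] [cite: Balaban1982Higgs1, Prop. 2.1 (2.24) p.610] -/
theorem holder_near_currency (hL2 : 2 ≤ P.L) (hkK : k ≤ P.K) {δ ρ : ℝ} (hδ : 0 < δ) (hδ1 : δ ≤ 1) (hρ : 1 ≤ ρ)
    {s δA cH cv cd α : ℝ} (hs : 0 ≤ s) (hδA : 0 ≤ δA) (hcH : 0 ≤ cH) (hcv : 0 ≤ cv) (hcd : 0 ≤ cd) (hα1 : α ≤ 1)
    (hP : ∀ b : HiggsLattice.PBond P 0, |Pf b| ≤ s)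
    (hregP : ∀ (z : HiggsLattice.Site P 0) (μ ν : Fin P.d), |Pf ⟨z.shift ν, μ⟩ - Pf ⟨z, μ⟩| ≤ δA) (i₀ : Ix N)
    {x₁ x₂ x' : HiggsLattice.Site P 0} {μ : Fin P.d} (hx₁ : x₁ ∈ Ω) (hx₁' : x₁.shift μ ∈ Ω) (hx₂ : x₂ ∈ Ω) (hx₂' : x₂.shift μ ∈ Ω)
    (hx' : x' ∈ Ω) (Γ : List (HiggsLattice.Site P 0))
    (hH2 : ∀ y ∈ Ω, ∑ i : Ix N, ‖holT C Y x₁ x₂ Γ μ (propagatorK C Ω X msq a k (cb P N 0 (y, i)))‖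
      ≤ (P.mesh 0 * (HiggsLattice.Site.tdist x₁ x₂ : ℝ)) ^ α * (maj P k cH (1 - α) δ x₁ y + maj P k cH (1 - α) δ x₂ y))
    (hV : ∀ u, ∑ i' : Ix N, ‖propagatorK C Ω X' msq a k (cb P N 0 (x', i')) u‖ ≤ maj P k cv 2 δ u x')
    (hD : ∀ b ∈ inB Ω Pf, ∑ i' : Ix N, ‖covDeriv C Y (propagatorK C Ω X' msq a k (cb P N 0 (x', i'))) b‖ ≤ maj P k cd 1 δ b.src x')
    (Fc : Finset (Σ ν : Fin P.d, ZMod (P.sitesPerDir 0 ν)))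
    (hexF : ∀ b ∈ exB Ω Pf, ∃ f ∈ Fc, b.src f.1 = f.2) (henF : ∀ b ∈ enB Ω Pf, ∃ f ∈ Fc, b.tgt f.1 = f.2)
    (hfar : ∀ b : HiggsLattice.PBond P 0, (Pf b ≠ 0 ∨ Pf (pred b) ≠ 0) →
      Far P k ρ x₁ b.src ∧ Far P k ρ x₂ b.src ∧ Far P k ρ b.src x')
    (hfarT : ∀ b : HiggsLattice.PBond P 0, Pf b ≠ 0 → Far P k ρ x₁ b.tgt ∧ Far P k ρ x₂ b.tgt ∧ Far P k ρ b.tgt x')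
    (hfarZ : ∀ b : HiggsLattice.PBond P 0, Pf b ≠ 0 → ∀ z : HiggsLattice.Site P 0, blockIter k z = blockIter k b.src →
      Far P k ρ x₁ z ∧ Far P k ρ x₂ z) :
    (P.mesh 0 ^ P.d)⁻¹ * ∑ i' : Ix N,
        ‖holT C Y x₁ x₂ Γ μ (propagatorK C Ω X msq a k (srcV C Pf Y k Ω a (propagatorK C Ω X' msq a k (cb P N 0 (x', i')))))‖
      ≤ (P.mesh 0 * (HiggsLattice.Site.tdist x₁ x₂ : ℝ)) ^ α *
          ((2 * ((P.mesh 0 ^ P.d)⁻¹ * (farF P δ ρ * collarC P N k δ (1 - α) 0 2 cH 0 cv cd (|C.e| * s) ((P.mesh 0)⁻¹ * (|C.e| * δA)) ((|C.e| * s) ^ 2) 0 0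
                (|B1.aSeq a P.L k| * (P.mesh k)⁻¹ ^ 2 *
                  ((|C.e| * s * P.mesh 0 * (P.d * ((P.L : ℝ) ^ k - 1))) * (2 + |C.e| * s * P.mesh 0 * (P.d * ((P.L : ℝ) ^ k - 1)))))))
              + 2 * ((Fc.card : ℝ) * P.d * (((P.mesh 0)⁻¹ * (|C.e| * δA) + (P.mesh 0)⁻¹ * (|C.e| * s)) + (3 * ((P.mesh 0)⁻¹ * (|C.e| * s)) + 2 * (|C.e| * s) ^ 2)) *
                ((P.mesh 0 ^ P.d)⁻¹ * (farF P δ ρ * cH * (farC P δ * cv) * faceC P (δ / 2)))))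
            * P.mesh k * (P.mesh k * (P.mesh k ^ P.d)⁻¹ * (P.mesh k ^ α)⁻¹)) *
          Real.exp (-(δ / 4 * (min (HiggsLattice.Site.tdist x₁ x' : ℝ) (HiggsLattice.Site.tdist x₂ x' : ℝ) / (P.L : ℝ) ^ k))) := by
  have hθ : 0 ≤ (P.mesh 0 * (HiggsLattice.Site.tdist x₁ x₂ : ℝ)) ^ α :=
    Real.rpow_nonneg (mul_nonneg (P.mesh_pos 0).le (Nat.cast_nonneg _)) α
  have haK : 0 ≤ 1 - α := by linarith
  have hnear := holder_near_le C Ω Pf Y X X' a hmsq hak hΩ hL2 hkK hδ hδ1 hρ hs hδA hcH hcv hcd haK hθ hP hregP i₀ hx₁ hx₁' hx₂ hx₂'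
    hx' Γ hH2 hV hD Fc hexF henF hfar hfarT hfarZ
  have hεd : 0 ≤ (P.mesh 0 ^ P.d)⁻¹ := inv_nonneg.mpr (pow_nonneg (P.mesh_pos 0).le _)
  have hδ4 : 0 ≤ δ / 4 := by positivity
  have hF : 0 ≤ farF P δ ρ := (farF_pos hδ ρ).le
  have hES : 0 ≤ |C.e| * s := mul_nonneg (abs_nonneg _) hs
  have hm0 := B3Op116CollarSources.avgM_nonneg (P := P) C k hs
  have hκ₄0 : 0 ≤ (|B1.aSeq a P.L k| * (P.mesh k)⁻¹ ^ 2 *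
                  ((|C.e| * s * P.mesh 0 * (P.d * ((P.L : ℝ) ^ k - 1))) * (2 + |C.e| * s * P.mesh 0 * (P.d * ((P.L : ℝ) ^ k - 1))))) := by positivity
  have hκ₂0 : 0 ≤ (P.mesh 0)⁻¹ * (|C.e| * δA) := by have := (P.mesh_pos 0).le; positivity
  have hL1 : 1 < P.L := lt_of_lt_of_le one_lt_two hL2
  have hCn : 0 ≤ collarC P N k δ (1 - α) 0 2 cH 0 cv cd (|C.e| * s) ((P.mesh 0)⁻¹ * (|C.e| * δA)) ((|C.e| * s) ^ 2) 0 0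
                (|B1.aSeq a P.L k| * (P.mesh k)⁻¹ ^ 2 *
                  ((|C.e| * s * P.mesh 0 * (P.d * ((P.L : ℝ) ^ k - 1))) * (2 + |C.e| * s * P.mesh 0 * (P.d * ((P.L : ℝ) ^ k - 1))))) :=
    collarC_nonneg (N := N) (aK := 1 - α) (aKd := 0) hL1 k hδ (by norm_num) hcH le_rfl hcv hcd hES hκ₂0 (pow_nonneg hES 2) le_rfl le_rfl hκ₄0
  have hCf : 0 ≤ (farF P δ ρ * cH * (farC P δ * cv) * faceC P (δ / 2)) :=
    mul_nonneg (mul_nonneg (mul_nonneg hF hcH) (mul_nonneg (farC_pos (P := P) hδ).le hcv)) (faceC_nonneg (by positivity))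
  have hKEX : 0 ≤ (((P.mesh 0)⁻¹ * (|C.e| * δA) + (P.mesh 0)⁻¹ * (|C.e| * s)) + (3 * ((P.mesh 0)⁻¹ * (|C.e| * s)) + 2 * (|C.e| * s) ^ 2)) := by have := (P.mesh_pos 0).le; positivity
  -- the four tops in currency
  have t1 := top_le_holder_currency (P := P) (k := k) (mul_nonneg hF hCn) α hδ4 x₁ x₂ x' true
  have t2 := top_le_holder_currency (P := P) (k := k) (mul_nonneg hF hCn) α hδ4 x₁ x₂ x' false
  have t3 := top_le_holder_currency (P := P) (k := k) hCf α hδ4 x₁ x₂ x' true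
  have t4 := top_le_holder_currency (P := P) (k := k) hCf α hδ4 x₁ x₂ x' false
  simp only [if_true] at t1 t3
  simp only [Bool.false_eq_true, if_false] at t2 t4
  have hcard : 0 ≤ (Fc.card : ℝ) * P.d * (((P.mesh 0)⁻¹ * (|C.e| * δA) + (P.mesh 0)⁻¹ * (|C.e| * s)) + (3 * ((P.mesh 0)⁻¹ * (|C.e| * s)) + 2 * (|C.e| * s) ^ 2)) := by positivity
  -- combine
  calc (P.mesh 0 ^ P.d)⁻¹ * ∑ i' : Ix N,
        ‖holT C Y x₁ x₂ Γ μ (propagatorK C Ω X msq a k (srcV C Pf Y k Ω a (propagatorK C Ω X' msq a k (cb P N 0 (x', i')))))‖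
      ≤ (P.mesh 0 ^ P.d)⁻¹ * ((P.mesh 0 * (HiggsLattice.Site.tdist x₁ x₂ : ℝ)) ^ α *
          ((top P k (farF P δ ρ * collarC P N k δ (1 - α) 0 2 cH 0 cv cd (|C.e| * s) ((P.mesh 0)⁻¹ * (|C.e| * δA)) ((|C.e| * s) ^ 2) 0 0
                (|B1.aSeq a P.L k| * (P.mesh k)⁻¹ ^ 2 *
                  ((|C.e| * s * P.mesh 0 * (P.d * ((P.L : ℝ) ^ k - 1))) * (2 + |C.e| * s * P.mesh 0 * (P.d * ((P.L : ℝ) ^ k - 1)))))) (1 - α + 2 - 1) (δ / 4) x₁ x'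
            + top P k (farF P δ ρ * collarC P N k δ (1 - α) 0 2 cH 0 cv cd (|C.e| * s) ((P.mesh 0)⁻¹ * (|C.e| * δA)) ((|C.e| * s) ^ 2) 0 0
                (|B1.aSeq a P.L k| * (P.mesh k)⁻¹ ^ 2 *
                  ((|C.e| * s * P.mesh 0 * (P.d * ((P.L : ℝ) ^ k - 1))) * (2 + |C.e| * s * P.mesh 0 * (P.d * ((P.L : ℝ) ^ k - 1)))))) (1 - α + 2 - 1) (δ / 4) x₂ x')
          + (Fc.card : ℝ) * P.d * (((P.mesh 0)⁻¹ * (|C.e| * δA) + (P.mesh 0)⁻¹ * (|C.e| * s)) + (3 * ((P.mesh 0)⁻¹ * (|C.e| * s)) + 2 * (|C.e| * s) ^ 2)) *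
            (top P k (farF P δ ρ * cH * (farC P δ * cv) * faceC P (δ / 2)) (1 - α + 2 - 1) (δ / 4) x₁ x' + top P k (farF P δ ρ * cH * (farC P δ * cv) * faceC P (δ / 2)) (1 - α + 2 - 1) (δ / 4) x₂ x'))) :=
        mul_le_mul_of_nonneg_left hnear hεd
    _ = (P.mesh 0 * (HiggsLattice.Site.tdist x₁ x₂ : ℝ)) ^ α *
          (((P.mesh 0 ^ P.d)⁻¹ * top P k (farF P δ ρ * collarC P N k δ (1 - α) 0 2 cH 0 cv cd (|C.e| * s) ((P.mesh 0)⁻¹ * (|C.e| * δA)) ((|C.e| * s) ^ 2) 0 0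
                (|B1.aSeq a P.L k| * (P.mesh k)⁻¹ ^ 2 *
                  ((|C.e| * s * P.mesh 0 * (P.d * ((P.L : ℝ) ^ k - 1))) * (2 + |C.e| * s * P.mesh 0 * (P.d * ((P.L : ℝ) ^ k - 1)))))) (1 - α + 2 - 1) (δ / 4) x₁ x'
            + (P.mesh 0 ^ P.d)⁻¹ * top P k (farF P δ ρ * collarC P N k δ (1 - α) 0 2 cH 0 cv cd (|C.e| * s) ((P.mesh 0)⁻¹ * (|C.e| * δA)) ((|C.e| * s) ^ 2) 0 0
                (|B1.aSeq a P.L k| * (P.mesh k)⁻¹ ^ 2 *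
                  ((|C.e| * s * P.mesh 0 * (P.d * ((P.L : ℝ) ^ k - 1))) * (2 + |C.e| * s * P.mesh 0 * (P.d * ((P.L : ℝ) ^ k - 1)))))) (1 - α + 2 - 1) (δ / 4) x₂ x')
          + (Fc.card : ℝ) * P.d * (((P.mesh 0)⁻¹ * (|C.e| * δA) + (P.mesh 0)⁻¹ * (|C.e| * s)) + (3 * ((P.mesh 0)⁻¹ * (|C.e| * s)) + 2 * (|C.e| * s) ^ 2)) *
            ((P.mesh 0 ^ P.d)⁻¹ * top P k (farF P δ ρ * cH * (farC P δ * cv) * faceC P (δ / 2)) (1 - α + 2 - 1) (δ / 4) x₁ x'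
              + (P.mesh 0 ^ P.d)⁻¹ * top P k (farF P δ ρ * cH * (farC P δ * cv) * faceC P (δ / 2)) (1 - α + 2 - 1) (δ / 4) x₂ x')) := by ring
    _ ≤ _ := by
        refine (mul_le_mul_of_nonneg_left (add_le_add (add_le_add t1 t2) (mul_le_mul_of_nonneg_left (add_le_add t3 t4) hcard)) hθ).trans
          (le_of_eq ?_)
        ring

end NearCurrency

end Literature.MathematicalPhysics.QuantumFieldTheory.Balaban1983to89.B3Op116CollarHolderBinder

end
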